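import Summits.HodgeConjecture.CorCM.GaloisTwentyFourDegenerateModels
import Mathlib.GroupTheory.SpecificGroups.Quaternion
import HarnessLib

/-!
# `Gal(K/ℚ) ≅ Q₈ × C₅` is BAD: a simple DEGENERATE CM abelian 20-fold (the first arithmetic instance beyond order 32)

COR-CM (cell `pub-hodgecm2`), binder seat b04 (gen 24), count-neutral claim REAL-FACTOR — frontier instance (blanket
`CorCM/GaloisQuaternion*`, HOME/INBOX l.9747, b04).  HC_CM is NOT proved here; an unconditional negative-side example.
KERNEL ONLY: theorems (`decide` certificates); no definition, no named fact, no `sorry`.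

Context.  By part III of the claim (`exists_simple_degenerate_of_real_factor`) a compositum `K = M·L` of a totally real field
`M` and a Galois CM field `L` with a primitive type is BAD for every `Gal(K/L) ∉ {1, C₂, C₂², C₂³, C₄, C_p, S₃}`.  For
`Gal(K/L) = C_p` and `L` a `Q₈`-CM field (`Gal(K/ℚ) ≅ Q₈ × C_p`, `c = (a², 1)` — every subgroup through the centre is normal,
no skew set, no equidistributed fibres) the verdict is ARITHMETIC: by gen 20's two-sheet analysis on `A = ⟨i⟩ × C_p` the
determinant of the odd block `ψ ⊗ λ` is `2·(N(U) + N(W))` with `N = N_{ℚ(ζ_p)(i)/ℚ(ζ_p)}` («`x² + y²`»), so a primitive type can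
only be degenerate when `−1` is a sum of two squares in `ℚ(ζ_p)`, i.e. when `ord_p(2)` is even (`p = 3, 5, 11, 13, …`; for
`p = 7` the seat's exhaustive two-sheet census finds NO primitive degenerate type).  Here the case `p = 5` is certified in the
kernel in gen 20's balanced-set format (`exists_simple_degenerate_of_model_balanced`): the type `T₀` with sheets
`t = (1,1,0,0,3)`, `t' = (1,3,2,2,1)` (fibre over `b ∈ ℤ/5` = `{a^{t_b}, a^{t_b+1}}` resp. `{x a^{t'_b}, x a^{t'_b+1}}`) has trivial
left stabiliser and is balanced over a 12-element set `D` moved by `c` (found in the annihilator lattice, `scratch-g24/g24f.py`).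
`Q₈ × C₃` (order 24) is gen 20's `GaloisTwentyFourDegenerateModels`.

References: Shimura (1998), §6.2 Thm. 3, §8.2 Prop. 26 [cite: Shimura1998]; Gordon (1999), Thm. 6.4, §9.3
[cite: Gordon1999HodgeAVSurvey]; Dodson (1984), §3.1.1, §5.3 [cite: Dodson1984].
-/

noncomputable section

open CategoryTheory CategoryTheory.Limits NumberField
open scoped BigOperators

namespace Summit.HodgeConjecture.CorCM.GaloisModels

open Literature.NumberTheory.ComplexMultiplication
open Literature.AlgebraicGeometry.Motives (AbelianVariety CMType)
open Literature.AlgebraicGeometry.HodgeTheory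
open Literature.AlgebraicGeometry.ComplexMultiplication (IsCMTypeRealisation)
open Literature.AlgebraicGeometry.Pohlmann1968
open Literature.Barriers.HodgeConjecture (divisorClassesSpan)
open QuaternionGroup

variable {K : Type} [Field K] [NumberField K] [IsCMField K] [IsGalois ℚ K]

/-- The central elements of order `≤ 2` of `Q₈ × C₅` are `1` and `(a², 1)`. [folklore] -/
theorem central_involution_quaternion_cyclicFive :
    ∀ x : QuaternionGroup 2 × Multiplicative (ZMod 5), x * x = 1 → (∀ y, x * y = y * x) →
      x = 1 ∨ x = (a 2, Multiplicative.ofAdd 0) := by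
  decide

/-- **`Gal(K/ℚ) ≅ Q₈ × C₅` with complex conjugation `(a², 1)` — `K` = (`Q₈`-CM field) · (real cyclic quintic field): a
simple DEGENERATE abelian `20`-fold with CM by `K`** (two-sheet type `t = (1,1,0,0,3)`, `t' = (1,3,2,2,1)`; balanced set of
`12` elements moved by `c`), with a rational `(p,p)` class outside the divisor ring on some power.
[cite: Shimura1998, §6.2 Thm. 3 and §8.2 Prop. 26] [cite: Gordon1999HodgeAVSurvey, Thm. 6.4] -/
theorem exists_simple_degenerate_of_quaternion_cyclicFive
    (e : (K ≃ₐ[ℚ] K) ≃* QuaternionGroup 2 × Multiplicative (ZMod 5))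
    (hc : e ((IsCMField.complexConj K).restrictScalars ℚ) = (a 2, Multiplicative.ofAdd 0)) :
    ∃ (Φ : CMType K) (φ₀ : K →+* ℂ) (A : AbelianVariety ℂ) (ι : 𝓞 K →+* End A)
      (θ : K →+* Module.End ℂ (complexBetti A.X 1)),
      IsPrimitive (ℂ ≃+* ℂ) Φ.1 φ₀ ∧ ¬ IsNondegenerate Φ ∧ IsCMTypeRealisation Φ A ι θ ∧ A.IsSimple ∧
      A.dim = 20 ∧
      ∃ n p : ℕ, ∃ x : complexBetti (⨁ fun _ : Fin n => A).X (2 * p), IsRationalClass x ∧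
        IsOfHodgeType (⨁ fun _ : Fin n => A).dim (⨁ fun _ : Fin n => A).X (2 * p) p p x ∧
        x ∉ divisorClassesSpan (⨁ fun _ : Fin n => A).X (⨁ fun _ : Fin n => A).dim p := by
  have h := exists_simple_degenerate_of_model_balanced e _ hc
    {(a 0, Multiplicative.ofAdd 2), (a 0, Multiplicative.ofAdd 3), (a 0, Multiplicative.ofAdd 4),
      (a 1, Multiplicative.ofAdd 0), (a 1, Multiplicative.ofAdd 1), (a 1, Multiplicative.ofAdd 2),
      (a 1, Multiplicative.ofAdd 3), (a 2, Multiplicative.ofAdd 0), (a 2, Multiplicative.ofAdd 1),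
      (a 3, Multiplicative.ofAdd 4), (xa 0, Multiplicative.ofAdd 1), (xa 1, Multiplicative.ofAdd 0),
      (xa 1, Multiplicative.ofAdd 4), (xa 2, Multiplicative.ofAdd 0), (xa 2, Multiplicative.ofAdd 2),
      (xa 2, Multiplicative.ofAdd 3), (xa 2, Multiplicative.ofAdd 4), (xa 3, Multiplicative.ofAdd 1),
      (xa 3, Multiplicative.ofAdd 2), (xa 3, Multiplicative.ofAdd 3)}
    (by decide) (by decide)
    {(a 0, Multiplicative.ofAdd 4), (a 1, Multiplicative.ofAdd 2), (a 1, Multiplicative.ofAdd 3),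
      (a 2, Multiplicative.ofAdd 1), (a 3, Multiplicative.ofAdd 0), (a 3, Multiplicative.ofAdd 1),
      (xa 0, Multiplicative.ofAdd 0), (xa 0, Multiplicative.ofAdd 4), (xa 1, Multiplicative.ofAdd 3),
      (xa 2, Multiplicative.ofAdd 1), (xa 2, Multiplicative.ofAdd 2), (xa 3, Multiplicative.ofAdd 1)}
    (by decide) (by decide)
  rwa [Fintype.card_prod, QuaternionGroup.card, Fintype.card_multiplicative, ZMod.card] at h

/-- **`Gal(K/ℚ) ≅ Q₈ × C₅` is BAD for the (unique) complex conjugation**: no hypothesis on `c` — the only central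
involution of `Q₈ × C₅` is `(a², 1)`. [cite: Shimura1998, §6.2 Thm. 3 and §8.2 Prop. 26]
[cite: Gordon1999HodgeAVSurvey, Thm. 6.4] -/
theorem exists_simple_degenerate_of_mulEquiv_quaternion_cyclicFive
    (e : (K ≃ₐ[ℚ] K) ≃* QuaternionGroup 2 × Multiplicative (ZMod 5)) :
    ∃ (Φ : CMType K) (φ₀ : K →+* ℂ) (A : AbelianVariety ℂ) (ι : 𝓞 K →+* End A)
      (θ : K →+* Module.End ℂ (complexBetti A.X 1)),
      IsPrimitive (ℂ ≃+* ℂ) Φ.1 φ₀ ∧ ¬ IsNondegenerate Φ ∧ IsCMTypeRealisation Φ A ι θ ∧ A.IsSimple ∧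
      A.dim = 20 ∧
      ∃ n p : ℕ, ∃ x : complexBetti (⨁ fun _ : Fin n => A).X (2 * p), IsRationalClass x ∧
        IsOfHodgeType (⨁ fun _ : Fin n => A).dim (⨁ fun _ : Fin n => A).X (2 * p) p p x ∧
        x ∉ divisorClassesSpan (⨁ fun _ : Fin n => A).X (⨁ fun _ : Fin n => A).dim p := by
  set c₀ := e ((IsCMField.complexConj K).restrictScalars ℚ) with hc₀
  have hcc : c₀ * c₀ = 1 := GaloisRank.model_complexConj_mul_self e rfl
  have hz : ∀ y, c₀ * y = y * c₀ := fun y => GaloisRank.model_complexConj_comm e rfl y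
  have hne : c₀ ≠ 1 := GaloisRank.model_complexConj_ne_one e rfl
  rcases central_involution_quaternion_cyclicFive c₀ hcc hz with h | h
  · exact absurd h hne
  · exact exists_simple_degenerate_of_quaternion_cyclicFive e h

end Summit.HodgeConjecture.CorCM.GaloisModels

end
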